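import Literature.NumberTheory.EllipticCurves.KatoAdditiveTwistedValueNeronIntegralityThree
import HarnessLib

/-!
# Kato's integral zeta elements read in NÉRON units at the ADDITIVE primes `p ∈ {5, 7}`, under the
# CHARACTER-side polar clause `χ(p) ∉ μ_{p−1}` or (`V(ℚ_p)` has a point of order `p` and `χ(p) ≠ 1`)
# — named fact

Topic `NumberTheory/EllipticCurves`. ONE named fact (`def … : Prop`, D-0014), the `p ∈ {5,7}` sibling of
`kato_neron_isIntegral_twistedSymbolSum_of_additive_three_polar` (`p = 3`, this file's import) and of
`kato_neron_isIntegral_twistedSymbolSum_of_additive_five_le` (`5 ≤ p`, off the Kosters–Pannekoek class):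
same conclusion and shape, with the binder `5 ≤ p` replaced by `p = 5 ∨ p = 7` and the CURVE-side
Kosters–Pannekoek hypothesis `7 < p ∨ (Nat.Coprime (orderOf p̄) (p − 1) ∧ V(ℚ_p)[p] = 0)` replaced by
the CHARACTER-side clause `χ(p)^(p−1) ≠ 1 ∨ ((∃ P ∈ V(ℚ_p), P ≠ 0 ∧ pP = 0) ∧ χ(p) ≠ 1)`.
Derivation = the `5 ≤ p` sibling's items 1 (lattice), 3 (values, symmetrised Euler factor) and 4 (unit
choice `c ≡ d ≡ 1 mod N`, `p ∣ N` ⟹ `T ≡ (1 − χ̄(c))(1 − χ̄(d))`, a `p`-unit for `χ(c), χ(d)` generators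
of `μ_n`, `p ∤ n`), with item 2 (receptacle) REPLACED by the polar computation (P1)–(P5) of the `p = 3`
file, read verbatim at `p ∈ {5, 7}` (ramification index `e = 1 < p − 1` throughout) with the
Kosters–Pannekoek invariant `ā ∈ 𝔽_p` of a `ℤ_p`-model of `V` with `a_i ∈ pℤ_p` (K–P Lemma 9, p. 6):
`g = T − ā·T^p`, `ā = \overline{3a₄/5}` (`p = 5`), `ā = \overline{4a₆/7}` (`p = 7`) (K–P §3.3.1 table,
p. 7, "we explicitly compute the polynomial g = [p](T)/p (mod pO_K)": `p = 5`: "[p](T) = 5T − 1248a₄T⁵ + …,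
g = T − \overline{3a₄/5}T⁵"; `p = 7`: "[p](T) = 7T − 6720a₄T⁵ − 352944a₆T⁷ + …, g = T − \overline{4a₆/7}T⁷";
`1248 ≡ 3 (mod 5)`, `352944 ≡ 4 (mod 7)`, `7 ∣ 6720`); K–P Thm. 1 (iii) "p = 5 and N_{k/𝔽_p}(\overline{3a₄/5}) = 1", (iv) "p = 7
and N_{k/𝔽_p}(\overline{4a₆/7}) = 1" (p. 3), Cor. 2 (iii) "p = 5 and a₄ ≡ 10 mod 25", (iv) "p = 7 and
a₆ ≡ 14 mod 49" (p. 3), Lemma 7 / Lemma 8 (p. 5: `[p]` induces `g : E₀/E₁ = k → E₁/E₂ = k`, additive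
polynomial of the table; `E₀(K)[p] ↪ ker g`). (P1) `M₀ := log_ω E₀(K_v) = {u ∈ O_v : ū ∈ im g} ⊇ pO_v`
(`log_ω : E₁(K_v) → pO_v` bijective since `e = 1 < p − 1`; `pE₀ ⊆ E₁`; `log T ≡ T mod p²O_v` for
`T ∈ pO_v`, `p` odd); (P2) the trace-orthogonal of `im g` in `k_v = 𝔽_{p^f}` is `ℓ_ā := {y : y^p = āy}`
(`Tr(y·āx^p) = Tr((āy)^{1/p}·x)`), of dimension `≤ 1`, non-zero iff `ā ≠ 0 ∧ ā^f = 1` (= K–P (iii)/(iv),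
`N_{k/𝔽_p}(ā) = ā^f` for `ā ∈ 𝔽_p`); (P3) `R_v := M₀^∨ = O_v + p⁻¹ℤ_p·ỹ` with `σ(ỹ) ≡ ā·ỹ (mod p)`: the
polar line is a Frobenius eigenline with eigenvalue `ā` (Teichmüller lift `ω(ā) ∈ μ_{p−1}`); (P4)
`exp*_ω H¹(K_v, T_pV) ⊆ (log_ω V(K_v))^∨ ⊆ R_v` (integral cup product / local Tate duality, stated with
`V(K_v)`; `[V(K_v) : E₀(K_v)] ≤ 4` is prime to `p`); (P5) for `X ∈ ∏_{v∣p} R_v`, `Y := pX` satisfies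
`σ_p Y ≡ ã·Y (mod p)` and the substitution `b ↦ pb` in `Λ := Σ_b χ(b)σ_b(X)` gives
`(1 − χ(p)ã)·pΛ ≡ 0 (mod p)`; `1 − χ(p)ã` is a `p`-adic unit iff `χ(p)·ω(ā) ≠ 1` (roots of unity of order
prime to `p` are distinct modulo every prime over `p`). HENCE `Λ` is `p`-integral (α) whenever
`χ(p)^(p−1) ≠ 1` (`χ(p) ∉ μ_{p−1} ∋ ω(ā)⁻¹`; curve-free), and (β) whenever `V(ℚ_p)` has a point `P` of
order `p` and `χ(p) ≠ 1`: `P ∈ E₀(ℚ_p)` because `[V(ℚ_p) : E₀(ℚ_p)] ≤ 4 < p`, so `E₀(ℚ_p)[p] ≠ 0` and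
`ā = 1` by K–P Cor. 2 (iii)/(iv) (`f = 1`, `N(ā) = ā`). The excluded case of the `5 ≤ p` sibling
(`gcd(f, p−1) = 1 ∧ V(ℚ_p)[p] = 0` ⟹ `ā^f ≠ 1` ⟹ `R_v = O_v`) is the case of NO polar part; this file
treats the polar part when it is present. The derivation ((P1)–(P5), (α), (β)) was written by the cell's
Euler-system planner (MEMO-es §20.2, with a machine check of (P2)/(P3): 47/47 cases `p ∈ {3,5,7}`,
`f ≤ 6, 4, 3`, all `ā ∈ 𝔽_p^×` — orthogonal = `ℓ_ā`, `dim = [ā^f = 1]`, `ker g` = eigenline `ā⁻¹`; cell file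
es/E20-polar_check.out), re-derived by the vendoring seat (cell typer, seat NOTES «F-es-24 CHECK»: (P1) holds
with or without torsion in `E₀(K_v)` since `log_ω` kills `ker g` and `pE₀ ⊇ pE₁ = E₂` by K–P Prop. 10; the
table's coefficients reduce to the stated `ā`; (β) uses only `c_p ≤ 4 < p`), and CHECKED independently by the
cell's statement refuter (REFUTER-ref1 §R40, 2026-08-28: (P1)–(P5), (α), (β) re-derived at `p ∈ {5, 7}` from
K–P Thm. 1 (iii)/(iv), Cor. 2 (iii)/(iv), Lemmas 7–9, Thm. 12 and the §3.3.1 table; independent `𝔽_{p^f}`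
check of (P2)/(P3) 29/29; `ā` is well defined on the models of Lemma 9 because `ū⁴ = 1` in `𝔽₅`, `ū⁶ = 1` in
`𝔽₇`; BC7 probe of this statement CLEAN; every binder load-bearing; verdict F-es-24 SURVIVES — CLEAN);
literature-placement audit REFUTER-ref2 R-es-20 requested. CONSISTENCY (E20-KP57-CENSUS-v1, ecdata `N ≤ 5·10⁵`): the
Kosters–Pannekoek-exceptional optimal curves (`ā = 1`) number 14 086 at `p = 5` and 3 363 at `p = 7`;
Cremona's Manin constant is `1` on all of them (and on all 17 590 + 3 679 curves of their classes), as the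
consumer (β ⟹ `p ∤ c` via the bsd-wall tame-twist lever on the mirror Legendre side) predicts.
Flag for the referee: `Kato-(8.1.3)-9.7-6.6-KostersPannekoek-3.3.1-additive-five-seven-twisted-Neron-reading-polar`
(non-verbatim steps: the sibling's three and (P1)–(P5); not in print as a statement — nearest printed
phenomenon: Delbourgo 2002 §1, the correction `ℓ_p(E)` for the same pole of `exp*`). No `_holds` (size XL:
Kato's explicit reciprocity law). Never stronger than the derivation: every binder of the derivation is
kept, and the conclusion is its last line.

## References

* K. Kato, Astérisque 295 (2004): (8.1.2)–(8.1.3) (p. 180), Thm. 6.6 (p. 163), Thm. 9.7 (p. 189),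
  Thm. 12.6 (2) (p. 222), remark after (12.8.1) (p. 223). [Kato2004Asterisque]
* M. Kosters, R. Pannekoek, arXiv:1703.07888 (2017): Thm. 1 (iii)/(iv), Cor. 2 (iii)/(iv), Lemma 7,
  Lemma 8, Lemma 9, Prop. 10, §3.3, §3.3.1 (table, p = 5, 7). [KostersPannekoek2017]
* C.-H. Kim, K. Nakamura, J. Number Theory 210 (2020) = arXiv:1808.07726: §2.1, Cor. 2.4. [KimNakamura2020]
* D. Delbourgo, J. Number Theory 95 (2002) 38–71: §1 (`ℓ_p(E)`), p. 50 (duality identity). [Delbourgo2002]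
* S. Bloch, K. Kato, The Grothendieck Festschrift I (1990): §3 (Prop. 3.8, Def. 3.10, (3.11)). [BlochKato1990]
* C. Wuthrich, Doc. Math. 19 (2014): §3 Prop. 8. [Wuthrich2014]
* B. Mazur, J. Tate, J. Teitelbaum, Invent. Math. 84 (1986): §I.8 (8.6). [MazurTateTeitelbaum1986]
-/

noncomputable section

open scoped MatrixGroups ModularForm Classical

open CongruenceSubgroup Literature.NumberTheory.EllipticCurves.ModularForms

namespace Literature.NumberTheory.EllipticCurves

/-- **Kato's Euler system read in Néron units at the ADDITIVE prime `p ∈ {5, 7}` with `E[p]` irreducible,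
for every primitive Dirichlet character `χ` of order prime to `p`, conductor `m` prime to `pN`, under the
polar clause `χ(p)^(p−1) ≠ 1 ∨ (V(ℚ_p) has a point of order p ∧ χ(p) ≠ 1)`: the `N`-imprimitive
(symmetrised) Birch–Manin twisted value is `p`-integral against the NÉRON periods** — the `p ∈ {5,7}`
sibling of `kato_neron_isIntegral_twistedSymbolSum_of_additive_five_le` (curve-side Kosters–Pannekoek
clause) and of `kato_neron_isIntegral_twistedSymbolSum_of_additive_three_polar` (`p = 3`). A derived
reading (weaker than the derivation, never stronger) of: K. Kato, Astérisque 295 (2004), **(8.1.3)**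
(p. 180), **Thm. 9.7** (p. 189), **Thm. 6.6 (1)** (p. 163; `T = (c² − c^uχ̄(c))(d² − d^vχ̄(d))`, BOTH characters barred as printed (DD-213),
`c ≡ d ≡ 1 mod N`), the remark after **(12.8.1)** (p. 223; with C. Wuthrich 2014 Prop. 8: `E[p]`
irreducible ⟹ every stable lattice is `p^aT_pE`); M. Kosters, R. Pannekoek, arXiv:1703.07888,
**Thm. 1 (iii)/(iv)**, **Cor. 2 (iii)/(iv)** (`a₄ ≡ 10 mod 25` / `a₆ ≡ 14 mod 49` over `ℚ_p`),
**Lemma 7, 8, 9**, **Prop. 10** and the **§3.3.1 table** (`g = T − \overline{3a₄/5}T⁵`,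
`g = T − \overline{4a₆/7}T⁷`); the local duality identity `Tr_{K/ℚ_p}[exp*(x), W] = inv(x ∪ exp W)`
(Delbourgo 2002 p. 50; Bloch–Kato 1990 §3; Kim–Nakamura 2020 §2.1, Cor. 2.4). DERIVATION = the
`5 ≤ p` sibling's items 1, 3, 4 with item 2 replaced by the polar computation (P1)–(P5) of the module
docstring: the dual `R_v` of `log_ω E₀(K_v)` is `O_v + p⁻¹·(Frobenius eigenline, eigenvalue ω(ā))`, and
`Σ_b χ(b)σ_b` kills the polar part whenever `χ(p)·ω(ā) ≠ 1` — uniformly in the curve when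
`χ(p) ∉ μ_{p−1}` (α), and when `V(ℚ_p)[p] ≠ 0` (then `ā = 1`) and `χ(p) ≠ 1` (β). HENCE: for `V/ℚ`
globally minimal with newform `f` at level `N`, `p ∈ {5,7}`, additive at `p`, `E[p]` irreducible,
`(m, pN) = 1`, `χ` primitive mod `m`, `χ ≠ 1`, `p ∤ ord χ`, polar clause, `ϖ ∈ ℚ`, `r ∈ ℂ` with
(`χ` even) `ϖ·Ω(V) = Ω⁺_f`, `∏_{ℓ∥N}(ℓ − a_ℓχ(ℓ))(ℓ − a_ℓχ(ℓ)⁻¹)·Σ_aχ(a){∞,a/m}_f = r·Ω⁺_f`, resp. (`χ`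
odd) `ϖ·|Ω⁻(V)| = Ω⁻_f`, same product `= r·Ω⁻_f·i`: `s·ϖ·r` is an algebraic integer for some `s ∈ ℕ`,
`p ∤ s`. Flag for the referee:
`Kato-(8.1.3)-9.7-6.6-KostersPannekoek-3.3.1-additive-five-seven-twisted-Neron-reading-polar` (non-verbatim
steps: the sibling's three, and (P1)–(P5), written out in the module docstring; re-derived by the vendoring
seat and by the cell's statement refuter, REFUTER-ref1 §R40, as (P1)–(P5) at `p = 3` were (REFUTER-ref1 §R34);
the cell's hand derivation is MEMO-es §20.2; placement audit REFUTER-ref2 R-es-20 requested; not in print as a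
statement — nearest printed phenomenon: Delbourgo 2002 §1, `ℓ_p(E)`). No `_holds` (size XL).
[cite: Kato2004Asterisque, (8.1.3) (p. 180), Thm. 9.7 (p. 189), Thm. 6.6 (1) (p. 163), remark after (12.8.1) (p. 223)]
[cite: KostersPannekoek2017, Thm. 1 (iii)/(iv), Cor. 2 (iii)/(iv), Lemma 7, Lemma 8, Lemma 9, Prop. 10, §3.3.1 (table p = 5, 7)]
[cite: KimNakamura2020, §2.1 (perfect pairing) and Cor. 2.4] [cite: Delbourgo2002, p. 50 (duality identity), §1]
[cite: BlochKato1990, §3 (Prop. 3.8, Def. 3.10, (3.11))] [cite: Wuthrich2014, §3 Prop. 8]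
[cite: MazurTateTeitelbaum1986, §I.8 (8.6)] -/
def kato_neron_isIntegral_twistedSymbolSum_of_additive_five_seven_polar : Prop :=
  ∀ (V : WeierstrassCurve ℚ) [V.IsElliptic] [V.IsGloballyMinimal] {N : ℕ} [NeZero N]
    (f : CuspForm (Gamma0 N) 2) (_ : IsNewformOf V f) (p : ℕ) [Fact p.Prime] (_ : p = 5 ∨ p = 7)
    (_ : ¬ V.HasGoodReductionAtPrime p) (_ : ¬ V.HasMultiplicativeReductionAtPrime p)
    (_ : V.HasIrreducibleModPGaloisRep p) (m : ℕ) [NeZero m] (_ : m.Coprime (p * N))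
    (χ : DirichletCharacter ℂ m) (_ : χ.IsPrimitive) (_ : χ ≠ 1) (_ : ¬ p ∣ orderOf χ)
    (_ : χ (p : ZMod m) ^ (p - 1) ≠ 1 ∨
      ((∃ P : (V.baseChange ℚ_[p]).toAffine.Point, P ≠ 0 ∧ p • P = 0) ∧ χ (p : ZMod m) ≠ 1))
    (ϖ : ℚ) (r : ℂ),
    (χ.Even → (ϖ : ℝ) * V.realPeriodRat = plusPeriod f →
      (∏ ℓ ∈ N.primeFactors with ¬ ℓ ^ 2 ∣ N,
          (((ℓ : ℂ) - (V.LFunction ℓ : ℂ) * χ (ℓ : ZMod m)) *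
            ((ℓ : ℂ) - (V.LFunction ℓ : ℂ) * (χ (ℓ : ZMod m))⁻¹))) *
          twistedSymbolSum f χ = r * (plusPeriod f : ℂ) →
      ∃ s : ℕ, ¬ p ∣ s ∧ IsIntegral ℤ ((s : ℂ) * ϖ * r)) ∧
    (χ.Odd → (ϖ : ℝ) * V.imaginaryPeriodRat = minusPeriod f →
      (∏ ℓ ∈ N.primeFactors with ¬ ℓ ^ 2 ∣ N,
          (((ℓ : ℂ) - (V.LFunction ℓ : ℂ) * χ (ℓ : ZMod m)) *
            ((ℓ : ℂ) - (V.LFunction ℓ : ℂ) * (χ (ℓ : ZMod m))⁻¹))) *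
          twistedSymbolSum f χ = r * (minusPeriod f : ℂ) * Complex.I →
      ∃ s : ℕ, ¬ p ∣ s ∧ IsIntegral ℤ ((s : ℂ) * ϖ * r))

end Literature.NumberTheory.EllipticCurves

end
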